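import Mathlib
import Summits.Ventures.PercRepro2.Defs
import Summits.Ventures.PercRepro2.Graph
import Summits.Ventures.PercRepro2.HullDefs
import Summits.Ventures.PercRepro2.HullFlip
import Summits.Ventures.PercRepro2.HullTheoremA
import Summits.Ventures.PercRepro2.AvoidSameSide

/-!
# The core-trivial and non-critical parts of the SAME-SIDE sums are nonnegative
(blind cell PercRepro2, mine-1 g9; MINE-1.md §23.7 (b) "`c₀ ≥ 0`", §25)

For a two-colouring `ζ`, a root `l` and vertices `o`, `v`, the same-side kernel is
`s_{o,l}(ζ) · s_{v,l}(ζ)` (`Hull.sideSign`). The per-hull same-side sums are NOT nonnegative in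
general (NEG-49: `C₄` with two pendant leaves at the antipode of `l`), but their CORE-TRIVIAL part
is, for every weight `ω ≥ 0` that depends on the configuration only through the hull and the core
(e.g. the avoidance indicator `1[T ∩ H_l = ∅]`, or the indicator of any family of hulls):

* `sideSign_flipO_le`: the side sign of any vertex `v` can only drop under the flip of the
  non-critical red piece of `o` (`+1 → −1` inside the piece, unchanged outside, by
  `rside_flip` / `bside_flip`);
* `sum_sideSign_sideSign_mul_nonneg` (THEOREM A form): `Σ_ζ 1[Good ζ] · s_o · s_v · ω(H_l, K_l) ≥ 0`;
* `sum_sideSign_sideSign_mul_nonneg_core` (THEOREM B form):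
  `Σ_ζ 1[K_l = {l}] · s_o · s_v · ω(H_l, K_l) ≥ 0`;
* `avoidSameSide_core_nonneg`: the core-trivial part of the avoidance sum `A(T;T)`
  (`AvoidSameSide.lean`) is nonnegative, `Σ_{ζ : 𝒮(T;T), K_l = {l}} s_o · s_v ≥ 0`;
* `hullFamily_core_nonneg`: the same for the indicator of an arbitrary family `𝒟` of hulls —
  the core-trivial part of every hull-family sum (in particular of every down-set sum of row
  (DOWN), MINE-1.md §25) is nonnegative.

The proof is the pairing argument of `HullTheoremA.lean` (`sum_sideSign_mul_nonneg`,
`sum_sideSign_mul_nonneg_core`) with `φ = s_v · ω`: the flip of the piece of `o` is an involution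
of `{Good}` exchanging the sides of `o`, preserves hull and core (so `ω` is invariant), and can
only lower `s_v`.
-/

namespace Summit.Ventures.PercRepro2

namespace Hull

open scoped Classical

variable {V : Type*} {E : Type*}

section Flip

variable {ends : E → Sym2 V} {ζ : Config E} {l o : V}
variable {R : Type*} [Ring R] [LinearOrder R] [IsOrderedRing R]

/-- The side sign of any vertex can only drop under the flip of the non-critical red piece of
`o`: it goes from `+1` to `−1` inside the piece and is unchanged outside it. -/
lemma sideSign_flipO_le (hR : o ∈ rside ends ζ l) (hnc : NonCritRed ends ζ l (piece ends ζ l o))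
    (v : V) : sideSign R ends (flipO ends ζ l o) l v ≤ sideSign R ends ζ l v := by
  have hP := isRedPiece_piece hR
  unfold flipO sideSign
  rw [rside_flip hP hnc, bside_flip hP hnc]
  by_cases hv : v ∈ piece ends ζ l o
  · have hvR : v ∈ rside ends ζ l := hP.subset hv
    have hvB : v ∉ bside ends ζ l := fun h => rside_disjoint_bside ζ l v hvR h
    simp only [Set.mem_sdiff, hv, not_true_eq_false, and_false, Set.mem_union, or_true,
      hvR, hvB, if_true, if_false]
    norm_num
  · simp only [Set.mem_sdiff, hv, not_false_eq_true, and_true, Set.mem_union, or_false, le_refl]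

end Flip

section Sums

variable [Fintype E] [DecidableEq E] {R : Type*} [Field R] [LinearOrder R] [IsStrictOrderedRing R]

/-- **THEOREM A for the same-side kernel**: for every `ω ≥ 0` depending only on hull and core,
`Σ_ζ 1[Good ζ] · s_{o,l} · s_{v,l} · ω(H_l, K_l) ≥ 0` (the non-critical part). -/
theorem sum_sideSign_sideSign_mul_nonneg (ends : E → Sym2 V) (l o v : V)
    (ω : Set V → Set V → R) (hω : ∀ H K, 0 ≤ ω H K) :
    0 ≤ ∑ ζ : Config E, if Good ends ζ l o then
      sideSign R ends ζ l o * (sideSign R ends ζ l v * ω (hull ends ζ l) (core ends ζ l)) else 0 :=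
  sum_sideSign_mul_nonneg ends l o
    (fun ζ => sideSign R ends ζ l v * ω (hull ends ζ l) (core ends ζ l))
    fun ζ hR hnc => by
      have h := flipO_red hR hnc
      rw [h.2.2.2.1, h.2.2.2.2]
      exact mul_le_mul_of_nonneg_right (sideSign_flipO_le hR hnc v) (hω _ _)

/-- **THEOREM B for the same-side kernel**: for every `ω ≥ 0` depending only on hull and core,
`Σ_ζ 1[K_l = {l}] · s_{o,l} · s_{v,l} · ω(H_l, K_l) ≥ 0` (the core-trivial part). -/
theorem sum_sideSign_sideSign_mul_nonneg_core (ends : E → Sym2 V) (l o v : V)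
    (ω : Set V → Set V → R) (hω : ∀ H K, 0 ≤ ω H K) :
    0 ≤ ∑ ζ : Config E, if core ends ζ l = {l} then
      sideSign R ends ζ l o * (sideSign R ends ζ l v * ω (hull ends ζ l) (core ends ζ l)) else 0 :=
  sum_sideSign_mul_nonneg_core ends l o
    (fun ζ => sideSign R ends ζ l v * ω (hull ends ζ l) (core ends ζ l))
    fun ζ hR hnc => by
      have h := flipO_red hR hnc
      rw [h.2.2.2.1, h.2.2.2.2]
      exact mul_le_mul_of_nonneg_right (sideSign_flipO_le hR hnc v) (hω _ _)

/-- The core-trivial part of the plain same-side sum (Harris' case) is nonnegative: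
`Σ_{ζ : K_l = {l}} s_{o,l} · s_{v,l} ≥ 0`. -/
theorem sum_sideSign_sideSign_nonneg_core (ends : E → Sym2 V) (l o v : V) :
    0 ≤ ∑ ζ : Config E, if core ends ζ l = {l} then
      sideSign R ends ζ l o * sideSign R ends ζ l v else 0 := by
  have h := sum_sideSign_sideSign_mul_nonneg_core (R := R) ends l o v (fun _ _ => 1)
    (fun _ _ => zero_le_one)
  simpa only [mul_one] using h

omit [Fintype E] [DecidableEq E] in
/-- The symmetric avoidance event `𝒮(T;T)` is the event `T ∩ H_l = ∅`. -/
lemma avoid_self_iff (ends : E → Sym2 V) (ζ : Config E) (l : V) (T : Set V) :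
    Avoid ends ζ l T T ↔ Disjoint T (hull ends ζ l) := by
  unfold Avoid hull
  rw [Set.disjoint_union_right, disjoint_comm, and_congr_right_iff]
  intro _
  exact disjoint_comm

/-- **The core-trivial part of `A(T;T)` is nonnegative** (MINE-1.md §23.7 (b), `c₀ ≥ 0`):
`Σ_{ζ : T ∩ H_l = ∅, K_l = {l}} s_{o,l} · s_{v,l} ≥ 0`. -/
theorem avoidSameSide_core_nonneg (ends : E → Sym2 V) (l o v : V) (T : Set V) :
    0 ≤ ∑ ζ : Config E, if Avoid ends ζ l T T ∧ core ends ζ l = {l} then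
      sideSign ℤ ends ζ l o * sideSign ℤ ends ζ l v else 0 := by
  have h := sum_sideSign_sideSign_mul_nonneg_core (R := ℚ) ends l o v
    (fun H _ => if Disjoint T H then 1 else 0) (fun H _ => by split_ifs <;> norm_num)
  have hcast : ((∑ ζ : Config E, if Avoid ends ζ l T T ∧ core ends ζ l = {l} then
      sideSign ℤ ends ζ l o * sideSign ℤ ends ζ l v else 0 : ℤ) : ℚ) =
      ∑ ζ : Config E, if core ends ζ l = {l} then
        sideSign ℚ ends ζ l o * (sideSign ℚ ends ζ l v *
          (if Disjoint T (hull ends ζ l) then (1 : ℚ) else 0)) else 0 := by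
    push_cast
    refine Finset.sum_congr rfl fun ζ _ => ?_
    rw [avoid_self_iff]
    by_cases hK : core ends ζ l = {l} <;> by_cases hD : Disjoint T (hull ends ζ l) <;>
      simp only [hK, hD, and_true, and_false, if_true, if_false, mul_one, mul_zero, sideSign,
        Int.cast_sub, Int.cast_ite, Int.cast_one, Int.cast_zero]
  exact_mod_cast hcast ▸ h

/-- **The core-trivial part of any hull-family sum is nonnegative**: for every family `𝒟` of
vertex sets, `Σ_{ζ : H_l ∈ 𝒟, K_l = {l}} s_{o,l} · s_{v,l} ≥ 0` — in particular the core-trivial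
part of every down-set sum of the row (DOWN) (MINE-1.md §25). -/
theorem hullFamily_core_nonneg (ends : E → Sym2 V) (l o v : V) (𝒟 : Set (Set V)) :
    0 ≤ ∑ ζ : Config E, if hull ends ζ l ∈ 𝒟 ∧ core ends ζ l = {l} then
      sideSign ℤ ends ζ l o * sideSign ℤ ends ζ l v else 0 := by
  have h := sum_sideSign_sideSign_mul_nonneg_core (R := ℚ) ends l o v
    (fun H _ => if H ∈ 𝒟 then 1 else 0) (fun H _ => by split_ifs <;> norm_num)
  have hcast : ((∑ ζ : Config E, if hull ends ζ l ∈ 𝒟 ∧ core ends ζ l = {l} then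
      sideSign ℤ ends ζ l o * sideSign ℤ ends ζ l v else 0 : ℤ) : ℚ) =
      ∑ ζ : Config E, if core ends ζ l = {l} then
        sideSign ℚ ends ζ l o * (sideSign ℚ ends ζ l v *
          (if hull ends ζ l ∈ 𝒟 then (1 : ℚ) else 0)) else 0 := by
    push_cast
    refine Finset.sum_congr rfl fun ζ _ => ?_
    by_cases hK : core ends ζ l = {l} <;> by_cases hD : hull ends ζ l ∈ 𝒟 <;>
      simp only [hK, hD, and_true, and_false, if_true, if_false, mul_one, mul_zero, sideSign,
        Int.cast_sub, Int.cast_ite, Int.cast_one, Int.cast_zero]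
  exact_mod_cast hcast ▸ h

end Sums

end Hull

end Summit.Ventures.PercRepro2
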